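import Summits.MatrixMultiplication.OmegaCensus.STPPSmallPatternNone211K23
import Summits.MatrixMultiplication.OmegaCensus.STPPSmallPatternNone211K4A
import Summits.MatrixMultiplication.OmegaCensus.STPPSmallPatternNone211K4B
import Summits.MatrixMultiplication.OmegaCensus.STPPSmallPatternNone211K5A
import Summits.MatrixMultiplication.OmegaCensus.STPPSmallPatternNone211K5B
import Summits.MatrixMultiplication.OmegaCensus.STPPSmallPatternNone211K5Z20
import Summits.MatrixMultiplication.OmegaCensus.STPPSmallPatternNone211K5Z21
import Summits.MatrixMultiplication.OmegaCensus.STPPSmallPatternNone211K5Z22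
import Summits.MatrixMultiplication.OmegaCensus.STPPSmallPatternNone211K5Z23
import Summits.MatrixMultiplication.OmegaCensus.STPPSmallPatternNone211ProductsA
import Summits.MatrixMultiplication.OmegaCensus.STPPSmallPatternNone211ProductsB
import Summits.MatrixMultiplication.OmegaCensus.STPPSmallPatternNone211K5P2x3x3
import Summits.MatrixMultiplication.OmegaCensus.STPPSmallPatternNone211K5P2x2x5
import Summits.MatrixMultiplication.OmegaCensus.STPPSmallPatternWitnesses
import Summits.MatrixMultiplication.OmegaCensus.STPP222SqNoneBelow24
import Summits.MatrixMultiplication.OmegaCensus.STPPPatternMonotonicity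
import Literature.Computability.AlgebraicComplexity.STPPMapHom

/-!
# ω-census, small STPP pattern `(2,1,1)^k`: NO finite abelian group of order `≤ 23` admits `(2,1,1)⁵` (kernel); the `T1` onsets

HONEST FRAMING (pub-omega census; verbatim): lottery ticket; floor = certified bounds/negative ranges.
Census STRUCTURE bookkeeping of the STPP track (seat pub-omega-stpp-3, gen 23; STRUCTURE row B5: the threshold column
`T1(H) = max {k : (2,1,1)^k ⊆ H}`, until now ENGINE ×2/×3 on its lower sides), not progress on `ω`: small patterns in small
groups bound no exponent.

CAPSTONES of the kernel-search files `STPPSmallPatternNone211*.lean` (engine `STPPSmallPatternKernelSearch.lean`, reflection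
`STPPSmallPatternKernel{Bits,Invariant,Reflect,Product}.lean`), over ALL finite abelian groups (structure theorem + the generic
embedding `exists_emb_of_dom` of `STPP222CubeFrom46.lean`, exactly as in `STPP222SqNoneBelow24.lean`):
* `not_exists_isSTPP_211pow5_of_card_le` — **no finite abelian group of order `≤ 23` admits an STPP family of size pattern
  `(2,1,1)⁵`** (CKSU Def. 5.1, tree `IsSTPP`); with the tree's witness `exists_isSTPP_211pow5_zmod24` (`ℤ/24`, file
  `STPPSmallPatternWitnesses.lean`): the least order of an abelian group hosting `(2,1,1)⁵` is EXACTLY `24` (`stpp211pow5_onset_eq_24`);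
* `not_exists_isSTPP_211pow4_of_card_le` (`≤ 15`; `ℤ/2 × ℤ/8` hosts `(2,1,1)⁴`, so the all-abelian onset of `(2,1,1)⁴` is `16`,
  the cyclic one `18`: `ℤ/16`, `ℤ/17` fail, `ℤ/18` hosts), `not_exists_isSTPP_211pow3_of_card_le` (`≤ 11`; `ℤ/12` hosts),
  `not_exists_isSTPP_211pow2_of_card_le` (`≤ 5`; `ℤ/6` hosts).
Orders below `2k` are excluded by disjointness of the pairs `Aᵢ` (`two_mul_le_card_of_isSTPP_211`); every other order by the
kernel theorem of its group (cyclic groups of composite order read on `SeedType [q₁, q₂]` through the Chinese remainder theorem;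
smaller `k` lifted by sub-families, `not_exists_isSTPP_of_embedding`).

References: H. Cohn, R. Kleinberg, B. Szegedy, C. Umans, FOCS 2005 (arXiv:math/0511460), Def. 5.1.  Record: pub-omega HOME
`pub-omega-stpp-3-g23/`; engine cross-checks of every cell (not used by the proofs): lister2/lister2b (gen 22), gen211.c (gen 21),
ENG1's lister211 (T1 table of STRUCTURE.md B5).
-/

open Literature.Computability.AlgebraicComplexity Finset

namespace Summit.MatrixMultiplication.OmegaCensus

/-! ## 1. Generic facts about the size pattern `(2,1,1)^k` -/

section Generic

variable {H P : Type*} [AddCommGroup H] [AddCommGroup P]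

/-- Transport of a `(2,1,1)^k` family along an injective additive map. [cite: CohnKleinbergSzegedyUmans2005, Def. 5.1] -/
theorem exists_isSTPP_211_of_injective {k : ℕ} (φ : H →+ P) (hφ : Function.Injective φ)
    (h : ∃ A B C : Fin k → Finset H, IsSTPP A B C ∧ ∀ i, (A i).card = 2 ∧ (B i).card = 1 ∧ (C i).card = 1) :
    ∃ A B C : Fin k → Finset P, IsSTPP A B C ∧ ∀ i, (A i).card = 2 ∧ (B i).card = 1 ∧ (C i).card = 1 := by
  classical
  obtain ⟨A, B, C, hS, hc⟩ := h
  refine ⟨fun i => (A i).image φ, fun i => (B i).image φ, fun i => (C i).image φ, hS.map_of_injective φ hφ,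
    fun i => ?_⟩
  obtain ⟨hA, hB, hC⟩ := hc i
  exact ⟨by rw [card_image_of_injective _ hφ, hA], by rw [card_image_of_injective _ hφ, hB],
    by rw [card_image_of_injective _ hφ, hC]⟩

/-- Transfer of a `(2,1,1)^k` exclusion along an injective additive map between finite groups of equal cardinality.
[cite: CohnKleinbergSzegedyUmans2005, Def. 5.1] -/
theorem not_exists_isSTPP_211_of_card_eq {k : ℕ} [Finite P] (φ : H →+ P) (hφ : Function.Injective φ)
    (hcard : Nat.card H = Nat.card P)
    (hH : ¬ ∃ A B C : Fin k → Finset H, IsSTPP A B C ∧ ∀ i, (A i).card = 2 ∧ (B i).card = 1 ∧ (C i).card = 1) :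
    ¬ ∃ A B C : Fin k → Finset P, IsSTPP A B C ∧ ∀ i, (A i).card = 2 ∧ (B i).card = 1 ∧ (C i).card = 1 := by
  intro hP
  have hbij : Function.Bijective φ := hφ.bijective_of_nat_card_le (le_of_eq hcard.symm)
  let e : H ≃+ P := AddEquiv.ofBijective φ hbij
  exact hH (exists_isSTPP_211_of_injective e.symm.toAddMonoidHom e.symm.injective hP)

/-- Fewer triples: an exclusion of `(2,1,1)^k` excludes `(2,1,1)^{k'}` for `k ≤ k'` (sub-families). [folklore] -/
theorem not_exists_isSTPP_211_mono {k k' : ℕ} (hk : k ≤ k')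
    (h : ¬ ∃ A B C : Fin k → Finset H, IsSTPP A B C ∧ ∀ i, (A i).card = 2 ∧ (B i).card = 1 ∧ (C i).card = 1) :
    ¬ ∃ A B C : Fin k' → Finset H, IsSTPP A B C ∧ ∀ i, (A i).card = 2 ∧ (B i).card = 1 ∧ (C i).card = 1 :=
  not_exists_isSTPP_of_embedding (fun _ => 2) (fun _ => 1) (fun _ => 1) (fun _ => 2) (fun _ => 1) (fun _ => 1)
    (Fin.castLE hk) (Fin.castLE_injective hk) (fun _ => le_rfl) (fun _ => le_rfl) (fun _ => le_rfl) h

/-- **Packing: `2k ≤ |H|`** — in the difference model (`exists_isSTPP_211_iff`) the `k` pairs are pairwise disjoint.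
[cite: CohnKleinbergSzegedyUmans2005, Def. 5.1] -/
theorem two_mul_le_card_of_isSTPP_211 [Fintype H] [DecidableEq H] {k : ℕ}
    (h : ∃ A B C : Fin k → Finset H, IsSTPP A B C ∧ ∀ i, (A i).card = 2 ∧ (B i).card = 1 ∧ (C i).card = 1) :
    2 * k ≤ Fintype.card H := by
  obtain ⟨p, q, c, hpq, hD, -⟩ := exists_isSTPP_211_iff.1 h
  have hcard : (Finset.univ.biUnion fun i : Fin k => ({p i, q i} : Finset H)).card = 2 * k := by
    rw [Finset.card_biUnion (fun i _ j _ hij => hD i j hij), Finset.sum_congr rfl (fun i _ => Finset.card_pair (hpq i)),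
      Finset.sum_const, Finset.card_univ, Fintype.card_fin, smul_eq_mul, mul_comm]
  rw [← hcard]; exact Finset.card_le_univ _

/-- Packing, `Nat.card` form: a finite abelian group hosting `(2,1,1)^k` has at least `2k` elements.
[cite: CohnKleinbergSzegedyUmans2005, Def. 5.1] -/
theorem two_mul_le_natCard_of_isSTPP_211 [Finite H] {k : ℕ}
    (h : ∃ A B C : Fin k → Finset H, IsSTPP A B C ∧ ∀ i, (A i).card = 2 ∧ (B i).card = 1 ∧ (C i).card = 1) :
    2 * k ≤ Nat.card H := by
  classical
  cases nonempty_fintype H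
  rw [Nat.card_eq_fintype_card]; exact two_mul_le_card_of_isSTPP_211 h

end Generic

/-- A `(2,1,1)^k` exclusion for `ℤ/(m n)` (`m`, `n` coprime) read on `SeedType [m, n] = ℤ/m × ℤ/n` (Chinese remainder theorem).
[cite: CohnKleinbergSzegedyUmans2005, Def. 5.1] -/
theorem not_exists_isSTPP_211_seedPair {m n k : ℕ} (h : m.Coprime n)
    (hneg : ¬ ∃ A B C : Fin k → Finset (ZMod (m * n)), IsSTPP A B C ∧ ∀ i, (A i).card = 2 ∧ (B i).card = 1 ∧ (C i).card = 1) :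
    ¬ ∃ A B C : Fin k → Finset (SeedType [m, n]), IsSTPP A B C ∧ ∀ i, (A i).card = 2 ∧ (B i).card = 1 ∧ (C i).card = 1 :=
  fun hex => hneg (exists_isSTPP_211_of_injective (ZMod.chineseRemainder h).symm.toAddEquiv.toAddMonoidHom
    (ZMod.chineseRemainder h).symm.injective hex)

/-! ## 2. The structure-theorem bridge (generic in the pattern length `k` and the order window) -/

/-- **The product case, generic.**  If every multiset of prime powers (each dividing some `1 ≤ E ≤ 23`) with product in
`[lo, 23]` is matched (domination with equal product, a kernel decision supplied as `hcore`) by a list of moduli whose seed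
group admits no `(2,1,1)^k` (`hnone`), then no `Π i, ℤ/(pᵢ^{eᵢ})` with `lo ≤ ∏ pᵢ^{eᵢ} ≤ 23` and all `pᵢ^{eᵢ} ∣ E` admits
`(2,1,1)^k`. [cite: CohnKleinbergSzegedyUmans2005, Def. 5.1] -/
theorem not_exists_isSTPP_211_pi {k lo : ℕ} {L : List (List ℕ)}
    (hcore : ∀ E ∈ List.range' 1 23, ∀ M ∈ subMS (capList26 E), lo ≤ M.prod → M.prod ≤ 23 →
      ∃ s ∈ L, dom s M = true ∧ s.prod = M.prod)
    (hnone : ∀ s ∈ L, ¬ ∃ A B C : Fin k → Finset (SeedType s), IsSTPP A B C ∧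
      ∀ i, (A i).card = 2 ∧ (B i).card = 1 ∧ (C i).card = 1)
    {ι : Type} [Fintype ι] [DecidableEq ι] (p e : ι → ℕ) (hp : ∀ i, (p i).Prime)
    {E : ℕ} (hE1 : 1 ≤ E) (hE23 : E ≤ 23) (hdvd : ∀ i, p i ^ e i ∣ E) (hlo : lo ≤ ∏ i, p i ^ e i)
    (h23 : ∏ i, p i ^ e i ≤ 23) :
    ¬ ∃ A B C : Fin k → Finset (Π i, ZMod (p i ^ e i)), IsSTPP A B C ∧
      ∀ i, (A i).card = 2 ∧ (B i).card = 1 ∧ (C i).card = 1 := by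
  have hq0 : ∀ i, p i ^ e i ≠ 0 := fun i => pow_ne_zero _ (hp i).ne_zero
  haveI : ∀ i, NeZero (p i ^ e i) := fun i => ⟨hq0 i⟩
  set M : Multiset ℕ := (Finset.univ.filter fun i => 0 < e i).val.map fun i => p i ^ e i with hM
  have hprodeq : M.prod = ∏ i, p i ^ e i := by
    rw [hM, ← Finset.prod_eq_multiset_prod]
    exact Finset.prod_filter_of_ne fun i _ hi => Nat.pos_of_ne_zero fun h0 => hi (by rw [h0, pow_zero])
  have hmem : ∀ a ∈ M, a ∈ ppList23 ∧ a ∣ E := by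
    intro a ha
    obtain ⟨i, hi, rfl⟩ := Multiset.mem_map.1 ha
    have hi' : 0 < e i := (Finset.mem_filter.1 hi).2
    exact ⟨pow_mem_ppList23 (hp i) hi' (le_trans (Nat.le_of_dvd (by omega) (hdvd i)) hE23), hdvd i⟩
  have hEI : E ∈ List.range' 1 23 := List.mem_range'_1.2 ⟨hE1, by omega⟩
  have hle : M ≤ capMS (capList26 E) :=
    le_capMS_of_prod_le hEI (fun a ha => (hmem a ha).1) (fun a ha => (hmem a ha).2) (by rw [hprodeq]; exact h23)
  obtain ⟨s, hs, hD, hsprod⟩ := hcore E hEI M (mem_subMS_of_le _ _ hle) (by rw [hprodeq]; exact hlo)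
    (by rw [hprodeq]; exact h23)
  obtain ⟨φ, hφ, -⟩ := exists_emb_of_dom (fun i => p i ^ e i) hq0 s _ hD
  have hcard : Nat.card (SeedType s) = Nat.card (Π i, ZMod (p i ^ e i)) := by
    rw [card_seedType, hsprod, hprodeq, Nat.card_pi]
    simp
  exact not_exists_isSTPP_211_of_card_eq φ hφ hcard (hnone s hs)

/-- **The structure-theorem step, generic.**  Under the hypotheses of `not_exists_isSTPP_211_pi` with `lo = 2k`, no finite
abelian group of order `≤ 23` admits `(2,1,1)^k` (order `< 2k`: packing). [cite: CohnKleinbergSzegedyUmans2005, Def. 5.1] -/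
theorem not_exists_isSTPP_211_of_card_le_23 {k : ℕ} {L : List (List ℕ)}
    (hcore : ∀ E ∈ List.range' 1 23, ∀ M ∈ subMS (capList26 E), 2 * k ≤ M.prod → M.prod ≤ 23 →
      ∃ s ∈ L, dom s M = true ∧ s.prod = M.prod)
    (hnone : ∀ s ∈ L, ¬ ∃ A B C : Fin k → Finset (SeedType s), IsSTPP A B C ∧
      ∀ i, (A i).card = 2 ∧ (B i).card = 1 ∧ (C i).card = 1)
    {G : Type*} [AddCommGroup G] [Finite G] (hG : Nat.card G ≤ 23) :
    ¬ ∃ A B C : Fin k → Finset G, IsSTPP A B C ∧ ∀ i, (A i).card = 2 ∧ (B i).card = 1 ∧ (C i).card = 1 := by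
  classical
  rintro ⟨A, B, C, hS, hc⟩
  have hlo : 2 * k ≤ Nat.card G := two_mul_le_natCard_of_isSTPP_211 ⟨A, B, C, hS, hc⟩
  obtain ⟨ι, _, p, hp, e, ⟨g⟩⟩ := AddCommGroup.equiv_directSum_zmod_of_finite G
  let f : G ≃+ (Π i, ZMod (p i ^ e i)) :=
    g.trans (DirectSum.linearEquivFunOnFintype ℕ ι (fun i => ZMod (p i ^ e i))).toAddEquiv
  have hE1 : 1 ≤ AddMonoid.exponent G := Nat.pos_of_ne_zero AddMonoid.exponent_ne_zero_of_finite
  have hEle : AddMonoid.exponent G ≤ 23 :=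
    le_trans (Nat.le_of_dvd Nat.card_pos AddGroup.exponent_dvd_nat_card) hG
  have hdvd : ∀ i, p i ^ e i ∣ AddMonoid.exponent G := fun i => by
    have hinj : Function.Injective (AddMonoidHom.single (fun j => ZMod (p j ^ e j)) i) :=
      Pi.single_injective (M := fun j => ZMod (p j ^ e j)) i
    have h1 : addOrderOf (f.symm (AddMonoidHom.single (fun j => ZMod (p j ^ e j)) i 1)) = p i ^ e i := by
      rw [AddEquiv.addOrderOf_eq, addOrderOf_injective _ hinj, ZMod.addOrderOf_one]
    rw [← h1]
    exact AddMonoid.addOrder_dvd_exponent _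
  have hcardeq : Nat.card G = ∏ i, p i ^ e i := by
    rw [Nat.card_congr f.toEquiv, Nat.card_pi]
    simp [Nat.card_zmod]
  have h := not_exists_isSTPP_211_pi hcore hnone p e hp hE1 hEle hdvd (by rw [← hcardeq]; exact hlo)
    (by rw [← hcardeq]; exact hG)
  exact h (exists_isSTPP_211_of_injective f.toAddMonoidHom f.injective ⟨A, B, C, hS, hc⟩)

/-! ## 3. `k = 5`: the twenty-one abelian groups of order `10 … 23` -/

/-- The abelian groups of order `10 … 23`, as lists of prime-power moduli (`SeedType`; coprime pairs = cyclic groups). -/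
def noneLists211K5 : List (List ℕ) :=
  [[2, 5], [11], [4, 3], [2, 2, 3], [13], [2, 7], [3, 5], [16], [2, 8], [4, 4], [2, 2, 4], [2, 2, 2, 2], [17], [2, 9],
   [2, 3, 3], [19], [4, 5], [2, 2, 5], [3, 7], [2, 11], [23]]

/-- COMBINATORIAL CORE for `k = 5` (kernel): every relevant multiset of prime powers with product in `[10, 23]` is matched. -/
theorem noneList211K5_of_capped : ∀ E ∈ List.range' 1 23, ∀ M ∈ subMS (capList26 E), 2 * 5 ≤ M.prod → M.prod ≤ 23 →
    ∃ s ∈ noneLists211K5, dom s M = true ∧ s.prod = M.prod := by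
  decide +kernel

/-- Each of the twenty-one groups admits no `(2,1,1)⁵` (the kernel cells; cyclic composite orders through the CRT; the order-12
product lifted from its `k = 4` cell). [cite: CohnKleinbergSzegedyUmans2005, Def. 5.1] -/
theorem not_211pow5_of_mem_noneLists211K5 : ∀ s ∈ noneLists211K5, ¬ ∃ A B C : Fin 5 → Finset (SeedType s),
    IsSTPP A B C ∧ ∀ i, (A i).card = 2 ∧ (B i).card = 1 ∧ (C i).card = 1 := by
  intro s hs
  simp only [noneLists211K5, List.mem_cons, List.mem_nil_iff, or_false] at hs
  rcases hs with rfl | rfl | rfl | rfl | rfl | rfl | rfl | rfl | rfl | rfl | rfl | rfl | rfl | rfl | rfl | rfl | rfl |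
    rfl | rfl | rfl | rfl
  · exact not_exists_isSTPP_211_seedPair (by norm_num) not_exists_isSTPP_211pow5_zmod10
  · exact not_exists_isSTPP_211pow5_zmod11
  · exact not_exists_isSTPP_211_seedPair (by norm_num) not_exists_isSTPP_211pow5_zmod12
  · exact not_exists_isSTPP_211_mono (by norm_num) not_exists_isSTPP_211pow4_z2_z2_z3
  · exact not_exists_isSTPP_211pow5_zmod13
  · exact not_exists_isSTPP_211_seedPair (by norm_num) not_exists_isSTPP_211pow5_zmod14
  · exact not_exists_isSTPP_211_seedPair (by norm_num) not_exists_isSTPP_211pow5_zmod15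
  · exact not_exists_isSTPP_211pow5_zmod16
  · exact not_exists_isSTPP_211pow5_z2_z8
  · exact not_exists_isSTPP_211pow5_z4_z4
  · exact not_exists_isSTPP_211pow5_z2_z2_z4
  · exact not_exists_isSTPP_211pow5_z2_z2_z2_z2
  · exact not_exists_isSTPP_211pow5_zmod17
  · exact not_exists_isSTPP_211_seedPair (by norm_num) not_exists_isSTPP_211pow5_zmod18
  · exact not_exists_isSTPP_211pow5_z2_z3_z3
  · exact not_exists_isSTPP_211pow5_zmod19
  · exact not_exists_isSTPP_211_seedPair (by norm_num) not_exists_isSTPP_211pow5_zmod20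
  · exact not_exists_isSTPP_211pow5_z2_z2_z5
  · exact not_exists_isSTPP_211_seedPair (by norm_num) not_exists_isSTPP_211pow5_zmod21
  · exact not_exists_isSTPP_211_seedPair (by norm_num) not_exists_isSTPP_211pow5_zmod22
  · exact not_exists_isSTPP_211pow5_zmod23

/-- **No finite abelian group of order `≤ 23` admits an STPP family of size pattern `(2,1,1)⁵`** (CKSU Def. 5.1, tree `IsSTPP`).
The lower side of the census' `T1` threshold at `k = 5`, IN THE KERNEL (24 cells by `decide +kernel` mask searches reflected through
Def. 5.1 + the structure theorem).  No `ω` bound follows. [cite: CohnKleinbergSzegedyUmans2005, Def. 5.1] -/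
theorem not_exists_isSTPP_211pow5_of_card_le {G : Type*} [AddCommGroup G] [Finite G] (hG : Nat.card G ≤ 23) :
    ¬ ∃ A B C : Fin 5 → Finset G, IsSTPP A B C ∧ ∀ i, (A i).card = 2 ∧ (B i).card = 1 ∧ (C i).card = 1 :=
  not_exists_isSTPP_211_of_card_le_23 noneList211K5_of_capped not_211pow5_of_mem_noneLists211K5 hG

/-- **ONSET of `(2,1,1)⁵` = 24, exactly, over all finite abelian groups (kernel both ways):** nothing of order `≤ 23` hosts it and
`ℤ/24` does (`exists_isSTPP_211pow5_zmod24`). [cite: CohnKleinbergSzegedyUmans2005, Def. 5.1] -/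
theorem stpp211pow5_onset_eq_24 :
    (∀ (G : Type) [AddCommGroup G] [Finite G], Nat.card G ≤ 23 →
      ¬ ∃ A B C : Fin 5 → Finset G, IsSTPP A B C ∧ ∀ i, (A i).card = 2 ∧ (B i).card = 1 ∧ (C i).card = 1) ∧
    ∃ A B C : Fin 5 → Finset (ZMod 24), IsSTPP A B C ∧ ∀ i, (A i).card = 2 ∧ (B i).card = 1 ∧ (C i).card = 1 :=
  ⟨fun _ _ _ hG => not_exists_isSTPP_211pow5_of_card_le hG, exists_isSTPP_211pow5_zmod24⟩

end Summit.MatrixMultiplication.OmegaCensus
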